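import Literature.Probability.Percolation.CerfUniquenessZoneBound
import Summits.CriticalPhenomena.PercolationContinuityZ3.Theses.PercFiniteBoxLRO
import HarnessLib

/-!
# `PercFiniteBoxLRO.Cerf2015BoxLRO16` (stmt-CriticalPhenomena-0860), tools I: Cerf's control on the
# number of arms (§8) for BOND percolation — the covering count and the improved central inequality

Helper file (`--supports stmt-CriticalPhenomena-0860`) for the bond-percolation transcription of
R. Cerf, *A lower bound on the two-arms exponent for critical percolation on the lattice*, Ann. Probab.
43 (2015), arXiv:1306.3105, Theorem 1.3 (`d = 3`, box `Λ(n^16)`), whose site version is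
`Literature.Probability.Percolation.Cerf2015_thm_1_3_three_holds`. The tree already holds the bond
versions of Cerf's §§3–7 (`AKN.integral_card_Hset_le`, `AKN.exists_real_edgeTwoArms_le`,
`AKN.real_twoArmsBox_mul_le`, `AKN.bconn_two_point_lower`); the box `Λ(n^16)` in `d = 3` needs a
two-arms exponent STRICTLY larger than `1/2`, i.e. one step of Cerf's §8–§9 improvement, whose
deterministic heart is formalised here for a general locally finite graph `G` (clusters are those of
the configuration restricted to the steps inside `L`, `𝒞 = AKN.bigClusters G L Λ ω`):

* `card_bigClusters_le_of_cover` — **Cerf §8, "a good box meets at most one cluster of `𝒞`, a bad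
  box at most `|∂ⁱⁿΛ(k)|`"**: if every cluster of `𝒞` meets one of the sets `B i` (`i ∈ I`,
  `B i ⊆ R i ⊆ L`), then `|𝒞| ≤ |I| + Σ_i 𝟙{box i is bad} |B i|`, where box `i` is bad when two points
  of `B i` lie in distinct clusters of the configuration restricted to `R i`, both reaching `∂ⁱⁿ(R i)`;
* `sum_hstat_le_sqrt_card` / `integral_card_Hset_le_of_count` — **the central inequality with the
  factor `E√|𝒞|` kept** (Cerf Lemma 5.1 as printed, bond form; the tree's `AKN.integral_card_Hset_le`
  bounds `|𝒞| ≤ |∂ⁱⁿL|` at once): `√|𝒞| ≤ |𝒞|/(2M) + M/2` for a free `M > 0`, so that only `E|𝒞|`, i.e.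
  the probabilities of the bad boxes, enter.

The lattice specialisation (covering `∂ⁱⁿΛ(n)` by translates of `Λ(k)`) is in the sequel
`…Cerf2015BoxLRO16Covering.lean`. This file introduces no definition.

## References

* R. Cerf, Ann. Probab. 43 (2015) 2458–2480, §5 (Lemma 5.1) and §8 (arXiv:1306.3105 pp. 8–9, 13)
  [Cerf2015].
-/

noncomputable section

namespace Summit.CriticalPhenomena.PercolationContinuityZ3.Theorems

namespace Cerf2015BoxLRO16

open Literature.Probability.Percolation Literature.Probability.Percolation.AKN
  Literature.Probability.LatticeModels MeasureTheory Finset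
open scoped Classical

section General

variable {V : Type*} [DecidableEq V] {G : SimpleGraph V} [G.LocallyFinite]

/-- **Sub-box arms.** If the cluster of `x` inside `L` reaches `∂ⁱⁿL` and contains `z ∈ R ⊆ L`, then
the cluster of `z` inside `R` reaches `∂ⁱⁿR` (stop the open path from `z` to `∂ⁱⁿL` at its first exit
from `R`; Cerf 2015, §8: the clusters of `𝒞` meeting `Λ_i` "go all the way till `∂ⁱⁿΛ(n+ℓ)`, hence
they realize the event `two-arms(Λ_i, ℓ)`"). [cite: Cerf2015, §8] -/
theorem reaches_of_mem_openClusterIn {L R : Finset V} (hRL : R ⊆ L) {ω : BondConfig V} {x z : V}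
    (hz : z ∈ openClusterIn (withinGraph G ↑L) ω x) (hzR : z ∈ R) (hx : Reaches G L ω x) :
    Reaches G R ω z := by
  obtain ⟨w, hw, hwx⟩ := hx
  have hwz : w ∈ openClusterIn (withinGraph G ↑L) ω z := by
    rw [openClusterIn_eq_of_mem hz]; exact hwx
  rw [mem_openClusterIn_iff] at hwz
  refine reaches_of_reachable (withinGraph_le G ↑L) hzR hwz ?_
  by_cases hwR : w ∈ R
  · right
    obtain ⟨-, y, hy, hadj⟩ := mem_innerBoundary_iff.1 hw
    exact mem_innerBoundary_iff.2 ⟨hwR, y, fun h => hy (hRL h), hadj⟩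
  · exact Or.inl hwR

/-- **Cerf 2015, §8, the count of `𝒞` through a covering (bond version).** Let `B i ⊆ R i ⊆ L`
(`i ∈ I`) be finitely many "boxes" such that every cluster of `𝒞 = bigClusters G L Λ ω` meets some
`B i`. Call `i` bad if two vertices of `B i` lie in distinct clusters of the configuration restricted
to `R i`, both reaching `∂ⁱⁿ(R i)`. Then `|𝒞| ≤ |I| + Σ_{i bad} |B i|` ("a good box meets at most one
cluster of `𝒞`; a bad box meets at most `|∂ⁱⁿΛ(k)|` [here: `|B i|`] clusters of `𝒞`").
[cite: Cerf2015, §8] -/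
theorem card_bigClusters_le_of_cover {ι : Type*} (I : Finset ι) (B R : ι → Finset V) {L Λ : Finset V}
    (hBR : ∀ i ∈ I, B i ⊆ R i) (hRL : ∀ i ∈ I, R i ⊆ L) (ω : BondConfig V)
    (hcov : ∀ C ∈ bigClusters G L Λ ω, ∃ i ∈ I, ∃ z ∈ B i, z ∈ C) :
    (bigClusters G L Λ ω).card ≤ I.card + ∑ i ∈ I,
      (if ∃ z ∈ B i, ∃ z' ∈ B i, z' ∉ openClusterIn (withinGraph G ↑(R i)) ω z ∧
          Reaches G (R i) ω z ∧ Reaches G (R i) ω z' then (B i).card else 0) := by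
  set 𝒞 := bigClusters G L Λ ω with h𝒞
  set part : ι → Finset (Finset V) := fun i => 𝒞.filter fun C => ∃ z ∈ B i, z ∈ C with hpart
  have hsub : 𝒞 ⊆ I.biUnion part := by
    intro C hC
    obtain ⟨i, hi, z, hz, hzC⟩ := hcov C hC
    exact Finset.mem_biUnion.2 ⟨i, hi, Finset.mem_filter.2 ⟨hC, z, hz, hzC⟩⟩
  -- a member of `part i` is the cluster of any of its points in `B i`, and reaches `∂ⁱⁿL`
  have hclus : ∀ i, ∀ C ∈ part i, ∀ z ∈ B i, z ∈ C → clus G L ω z = C ∧ Reaches G L ω z := by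
    intro i C hC z _ hzC
    obtain ⟨hC𝒞, -⟩ := Finset.mem_filter.1 hC
    obtain ⟨x, -, hreach, rfl⟩ := mem_bigClusters_iff.1 hC𝒞
    have hz := (mem_clus.1 hzC).2
    exact ⟨clus_eq_of_mem hz, (reaches_iff_of_mem hz).2 hreach⟩
  have hcard_le : ∀ i ∈ I, (part i).card ≤ (B i).card := by
    intro i _
    have : part i ⊆ (B i).image fun z => clus G L ω z := by
      intro C hC
      obtain ⟨-, z, hz, hzC⟩ := Finset.mem_filter.1 hC
      exact Finset.mem_image.2 ⟨z, hz, (hclus i C hC z hz hzC).1⟩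
    exact (Finset.card_le_card this).trans Finset.card_image_le
  have hcard_one : ∀ i ∈ I, ¬ (∃ z ∈ B i, ∃ z' ∈ B i,
      z' ∉ openClusterIn (withinGraph G ↑(R i)) ω z ∧ Reaches G (R i) ω z ∧ Reaches G (R i) ω z') →
      (part i).card ≤ 1 := by
    intro i hi hgood
    refine Finset.card_le_one.2 fun C hC C' hC' => ?_
    obtain ⟨-, z, hz, hzC⟩ := Finset.mem_filter.1 hC
    obtain ⟨-, z', hz', hz'C'⟩ := Finset.mem_filter.1 hC'
    obtain ⟨hCz, hrz⟩ := hclus i C hC z hz hzC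
    obtain ⟨hC'z', hrz'⟩ := hclus i C' hC' z' hz' hz'C'
    by_contra hne
    apply hgood
    refine ⟨z, hz, z', hz', fun hmem => hne ?_, ?_, ?_⟩
    · have hmemL : z' ∈ openClusterIn (withinGraph G ↑L) ω z :=
        openClusterIn_mono_graph (withinGraph_mono G (Finset.coe_subset.2 (hRL i hi))) ω z hmem
      exact hCz.symm.trans ((clus_eq_of_mem hmemL).symm.trans hC'z')
    · exact reaches_of_mem_openClusterIn (hRL i hi) (self_mem_openClusterIn _ ω z) (hBR i hi hz) hrz
    · exact reaches_of_mem_openClusterIn (hRL i hi) (self_mem_openClusterIn _ ω z') (hBR i hi hz') hrz'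
  calc 𝒞.card ≤ (I.biUnion part).card := Finset.card_le_card hsub
    _ ≤ ∑ i ∈ I, (part i).card := Finset.card_biUnion_le
    _ ≤ ∑ i ∈ I, (1 + (if ∃ z ∈ B i, ∃ z' ∈ B i, z' ∉ openClusterIn (withinGraph G ↑(R i)) ω z ∧
          Reaches G (R i) ω z ∧ Reaches G (R i) ω z' then (B i).card else 0)) := by
        refine Finset.sum_le_sum fun i hi => ?_
        by_cases hbad : ∃ z ∈ B i, ∃ z' ∈ B i, z' ∉ openClusterIn (withinGraph G ↑(R i)) ω z ∧
          Reaches G (R i) ω z ∧ Reaches G (R i) ω z'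
        · rw [if_pos hbad]; exact (hcard_le i hi).trans (Nat.le_add_left _ _)
        · rw [if_neg hbad]; exact hcard_one i hi hbad
    _ = I.card + ∑ i ∈ I, (if ∃ z ∈ B i, ∃ z' ∈ B i, z' ∉ openClusterIn (withinGraph G ↑(R i)) ω z ∧
          Reaches G (R i) ω z ∧ Reaches G (R i) ω z' then (B i).card else 0) := by
        rw [Finset.sum_add_distrib, Finset.sum_const, smul_eq_mul, mul_one]

/-- `√x ≤ x/(2M) + M/2` for `x ≥ 0 < M` (arithmetic–geometric mean; used in place of Jensen's
inequality `E√|𝒞| ≤ √(E|𝒞|)` of Cerf 2015, §8). [folklore] -/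
theorem sqrt_le_div_add (x : ℝ) (hx : 0 ≤ x) {M : ℝ} (hM : 0 < M) : Real.sqrt x ≤ x / (2 * M) + M / 2 := by
  have h1 : Real.sqrt x * (2 * M) ≤ x + M ^ 2 := by
    nlinarith [sq_nonneg (Real.sqrt x - M), Real.sq_sqrt hx, Real.sqrt_nonneg x]
  rw [div_add_div _ _ (by positivity) (by norm_num : (2 : ℝ) ≠ 0), le_div_iff₀ (by positivity)]
  nlinarith [h1]

/-- **The sum of the statistics over `𝒞`, pointwise, with `√|𝒞|` kept** (Cerf 2015, §5: on `ℰ`,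
`Σ_{C ∈ 𝒞} |h(C̄ ∩ Λ(n))| ≤ (ln n) √|𝒞| (Σ_C |C̄ ∩ Λ(n)|)^{1/2}`; bond form, and `√|𝒞|` replaced by
its upper bound `|𝒞|/(2M) + M/2`): for `Λ ⊆ L`, `0 < p < 1`, `t ≥ 0`, `M > 0`,
`Σ_{C ∈ 𝒞} h(touchIn Λ C) ≤ t √(2|E(Λ)|) (|𝒞|/(2M) + M/2) + 𝟙{some x ∈ Λ is bad} · 2|E(Λ)|/(p(1−p))`.
[cite: Cerf2015, §5] -/
theorem sum_hstat_le_card {L Λ : Finset V} (hΛL : Λ ⊆ L) (p : unitInterval) (hp0 : 0 < (p : ℝ))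
    (hp1 : (p : ℝ) < 1) {t : ℝ} (ht : 0 ≤ t) {M : ℝ} (hM : 0 < M) (ω : BondConfig V) :
    ∑ C ∈ bigClusters G L Λ ω, hstat p (touchIn G Λ C) ω ≤
      t * Real.sqrt (2 * (edgesIn G Λ).card) * (((bigClusters G L Λ ω).card : ℝ) / (2 * M) + M / 2) +
        (if ∃ x ∈ Λ, t * Real.sqrt ((touchIn G Λ (clus G L ω x)).card) < |hstat p (touchIn G Λ (clus G L ω x)) ω|
          then 2 * (edgesIn G Λ).card / ((p : ℝ) * (1 - p)) else 0) := by
  have h1p : 0 < 1 - (p : ℝ) := by linarith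
  have hsumcard : (∑ C ∈ bigClusters G L Λ ω, ((touchIn G Λ C).card : ℝ)) ≤ 2 * (edgesIn G Λ).card := by
    exact_mod_cast sum_card_touchIn_le (G := G) hΛL ω
  have hK0 : 0 ≤ ((bigClusters G L Λ ω).card : ℝ) / (2 * M) + M / 2 := by positivity
  have hA : 0 ≤ t * Real.sqrt (2 * (edgesIn G Λ).card) * (((bigClusters G L Λ ω).card : ℝ) / (2 * M) + M / 2) := by
    positivity
  by_cases hbad : ∃ x ∈ Λ, t * Real.sqrt ((touchIn G Λ (clus G L ω x)).card) < |hstat p (touchIn G Λ (clus G L ω x)) ω|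
  · rw [if_pos hbad]
    calc ∑ C ∈ bigClusters G L Λ ω, hstat p (touchIn G Λ C) ω
        ≤ ∑ C ∈ bigClusters G L Λ ω, ((touchIn G Λ C).card : ℝ) / ((p : ℝ) * (1 - p)) :=
          Finset.sum_le_sum fun C _ => (le_abs_self _).trans (abs_hstat_le p hp0 hp1 _ ω)
      _ = (∑ C ∈ bigClusters G L Λ ω, ((touchIn G Λ C).card : ℝ)) / ((p : ℝ) * (1 - p)) := by
          rw [Finset.sum_div]
      _ ≤ 2 * (edgesIn G Λ).card / ((p : ℝ) * (1 - p)) := div_le_div_of_nonneg_right hsumcard (by positivity)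
      _ ≤ _ := by linarith
  · rw [if_neg hbad, add_zero]
    push Not at hbad
    have hterm : ∀ C ∈ bigClusters G L Λ ω, hstat p (touchIn G Λ C) ω ≤ t * Real.sqrt ((touchIn G Λ C).card) := by
      intro C hC
      obtain ⟨x, hx, -, rfl⟩ := mem_bigClusters_iff.1 hC
      exact (le_abs_self _).trans (hbad x hx)
    calc ∑ C ∈ bigClusters G L Λ ω, hstat p (touchIn G Λ C) ω
        ≤ ∑ C ∈ bigClusters G L Λ ω, t * Real.sqrt ((touchIn G Λ C).card) := Finset.sum_le_sum hterm
      _ = t * ∑ C ∈ bigClusters G L Λ ω, Real.sqrt 1 * Real.sqrt ((touchIn G Λ C).card) := by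
          rw [Finset.mul_sum]; simp
      _ ≤ t * (Real.sqrt (∑ _C ∈ bigClusters G L Λ ω, (1 : ℝ)) *
            Real.sqrt (∑ C ∈ bigClusters G L Λ ω, ((touchIn G Λ C).card : ℝ))) :=
          mul_le_mul_of_nonneg_left (Real.sum_sqrt_mul_sqrt_le _ (fun _ => zero_le_one) (fun _ => Nat.cast_nonneg _)) ht
      _ ≤ t * ((((bigClusters G L Λ ω).card : ℝ) / (2 * M) + M / 2) * Real.sqrt (2 * (edgesIn G Λ).card)) := by
          refine mul_le_mul_of_nonneg_left (mul_le_mul ?_ (Real.sqrt_le_sqrt hsumcard)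
            (Real.sqrt_nonneg _) hK0) ht
          simp only [Finset.sum_const, nsmul_eq_mul, mul_one]
          exact sqrt_le_div_add _ (Nat.cast_nonneg _) hM
      _ = _ := by ring

/-- **The central inequality with a count of `𝒞` (Cerf 2015, Lemma 5.1 combined with the covering
bound of §8, bond version).** For `Λ ⊆ L` finite, `0 < p < 1`, `t ≥ 0`, `M > 0`: if pointwise
`|𝒞| ≤ a + Σ_{i ∈ I} b_i 𝟙_{S_i}` for measurable events `S_i` and constants `b_i`, then
`E_p|H| ≤ (1−p) t √(2|E(Λ)|) ((a + Σ_i b_i P_p(S_i))/(2M) + M/2) + (2|E(Λ)|/p) · 2|Λ||E(Λ)| e^{−2p²(1−p)²t²}`.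
With `M² = a + Σ_i b_i P_p(S_i)` the bracket is `√(E-bound of |𝒞|)`, Cerf's `E(|𝒞|)^{1/2}`.
[cite: Cerf2015, Lemma 5.1 and §8] -/
theorem integral_card_Hset_le_of_count [Countable V] {L Λ : Finset V} (hΛL : Λ ⊆ L) (p : unitInterval)
    (hp0 : 0 < (p : ℝ)) (hp1 : (p : ℝ) < 1) {t : ℝ} (ht : 0 ≤ t) {M : ℝ} (hM : 0 < M)
    {ι : Type*} (I : Finset ι) (S : ι → Set (BondConfig V)) (hS : ∀ i ∈ I, MeasurableSet (S i))
    (b : ι → ℝ) (a : ℝ)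
    (hcount : ∀ ω, ((bigClusters G L Λ ω).card : ℝ) ≤ a + ∑ i ∈ I, (S i).indicator (fun _ => b i) ω) :
    ∫ ω, ((Hset G L Λ ω).card : ℝ) ∂(bondPercolation G p) ≤
      (1 - p) * (t * Real.sqrt (2 * (edgesIn G Λ).card) *
          ((a + ∑ i ∈ I, b i * (bondPercolation G p).real (S i)) / (2 * M) + M / 2)) +
        2 * (edgesIn G Λ).card / p *
          (2 * Λ.card * (edgesIn G Λ).card * Real.exp (-2 * (p : ℝ) ^ 2 * (1 - p) ^ 2 * t ^ 2)) := by
  set μ := bondPercolation G p with hμ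
  have h1p : 0 < 1 - (p : ℝ) := by linarith
  obtain ⟨T, hT⟩ : ∃ T : ℝ, T = t * Real.sqrt (2 * (edgesIn G Λ).card) := ⟨_, rfl⟩
  have hT0 : 0 ≤ T := by rw [hT]; positivity
  obtain ⟨B, hB⟩ : ∃ B : ℝ, B = 2 * (edgesIn G Λ).card / ((p : ℝ) * (1 - p)) := ⟨_, rfl⟩
  obtain ⟨bad, hbad⟩ : ∃ bad : Set (BondConfig V), bad = {ω | ∃ x ∈ Λ,
    t * Real.sqrt ((touchIn G Λ (clus G L ω x)).card) < |hstat p (touchIn G Λ (clus G L ω x)) ω|} := ⟨_, rfl⟩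
  have hbadm : MeasurableSet bad := by rw [hbad]; exact measurableSet_bad (G := G) hΛL p t
  -- the counting random variable
  set N : BondConfig V → ℝ := fun ω => a + ∑ i ∈ I, (S i).indicator (fun _ => b i) ω with hN
  have hNi : Integrable N μ :=
    (integrable_const a).add (integrable_finsetSum _ fun i hi => (integrable_const (b i)).indicator (hS i hi))
  have hNint : ∫ ω, N ω ∂μ = a + ∑ i ∈ I, b i * μ.real (S i) := by
    rw [hN, integral_add (integrable_const a) (integrable_finsetSum _ fun i hi => (integrable_const (b i)).indicator (hS i hi)),
      integral_const, smul_eq_mul, probReal_univ, one_mul,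
      integral_finsetSum _ fun i hi => (integrable_const (b i)).indicator (hS i hi)]
    congr 1
    refine Finset.sum_congr rfl fun i hi => ?_
    rw [integral_indicator_const _ (hS i hi), smul_eq_mul, mul_comm]
  -- integrability of the three cardinalities
  have hFi : Integrable (fun ω => ((Fset G L Λ ω).card : ℝ)) μ :=
    integrable_card (Fset G L Λ) (fun ω => Finset.filter_subset _ _) (fun e he => measurableSet_mem_Fset L Λ he) μ
  have hGi : Integrable (fun ω => ((Gset G L Λ ω).card : ℝ)) μ :=
    integrable_card (Gset G L Λ) (fun ω => Finset.filter_subset _ _) (fun e he => measurableSet_mem_Gset L Λ he) μ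
  have hHi : Integrable (fun ω => ((Hset G L Λ ω).card : ℝ)) μ :=
    integrable_card (Hset G L Λ) (fun ω => Finset.filter_subset _ _) (fun e he => measurableSet_mem_Hset L Λ he) μ
  -- the pointwise bound
  have hpt : ∀ ω, ((Hset G L Λ ω).card : ℝ) ≤
      ((1 - p) * (T * (N ω / (2 * M) + M / 2)) + (1 - p) * B * bad.indicator (fun _ => (1 : ℝ)) ω) +
        (1 - p) / p * ((Fset G L Λ ω).card : ℝ) - ((Gset G L Λ ω).card : ℝ) := by
    intro ω
    rw [card_H_eq hΛL ω hp0.ne' h1p.ne']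
    have hS' := sum_hstat_le_card (G := G) hΛL p hp0 hp1 ht hM ω
    have hind : (if ∃ x ∈ Λ, t * Real.sqrt ((touchIn G Λ (clus G L ω x)).card) < |hstat p (touchIn G Λ (clus G L ω x)) ω|
        then 2 * ((edgesIn G Λ).card : ℝ) / ((p : ℝ) * (1 - p)) else 0) = B * bad.indicator (fun _ => (1 : ℝ)) ω := by
      by_cases h : ∃ x ∈ Λ, t * Real.sqrt ((touchIn G Λ (clus G L ω x)).card) < |hstat p (touchIn G Λ (clus G L ω x)) ω|
      · rw [if_pos h, Set.indicator_of_mem (show ω ∈ bad by rw [hbad]; exact h), mul_one, hB]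
      · rw [if_neg h, Set.indicator_of_notMem (show ω ∉ bad by rw [hbad]; exact h), mul_zero]
    rw [hind, ← hT] at hS'
    have hcnt : T * (((bigClusters G L Λ ω).card : ℝ) / (2 * M) + M / 2) ≤ T * (N ω / (2 * M) + M / 2) := by
      refine mul_le_mul_of_nonneg_left (add_le_add ?_ le_rfl) hT0
      exact div_le_div_of_nonneg_right (hcount ω) (by positivity)
    have hS2 : (1 - (p : ℝ)) * ∑ C ∈ bigClusters G L Λ ω, hstat p (touchIn G Λ C) ω ≤
        (1 - p) * (T * (N ω / (2 * M) + M / 2)) + (1 - p) * B * bad.indicator (fun _ => (1 : ℝ)) ω := by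
      have := mul_le_mul_of_nonneg_left (hS'.trans (add_le_add hcnt le_rfl)) h1p.le
      rw [mul_add] at this
      linarith [this]
    exact sub_le_sub_right (add_le_add hS2 le_rfl) _
  -- integrate
  have hX1 : Integrable (fun ω => (1 - (p : ℝ)) * (T * (N ω / (2 * M) + M / 2))) μ :=
    (((hNi.div_const _).add (integrable_const _)).const_mul T).const_mul _
  have hX2 : Integrable (fun ω => (1 - (p : ℝ)) * B * bad.indicator (fun _ => (1 : ℝ)) ω) μ :=
    ((integrable_const (1 : ℝ)).indicator hbadm).const_mul _
  have hX : Integrable (fun ω => (1 - (p : ℝ)) * (T * (N ω / (2 * M) + M / 2)) +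
      (1 - p) * B * bad.indicator (fun _ => (1 : ℝ)) ω) μ := hX1.add hX2
  have hW : Integrable (fun ω => (1 - (p : ℝ)) / p * ((Fset G L Λ ω).card : ℝ)) μ := hFi.const_mul _
  have hXW : Integrable (fun ω => ((1 - (p : ℝ)) * (T * (N ω / (2 * M) + M / 2)) +
      (1 - p) * B * bad.indicator (fun _ => (1 : ℝ)) ω) + (1 - (p : ℝ)) / p * ((Fset G L Λ ω).card : ℝ)) μ :=
    hX.add hW
  have hrhs_int : Integrable (fun ω => ((1 - (p : ℝ)) * (T * (N ω / (2 * M) + M / 2)) +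
      (1 - p) * B * bad.indicator (fun _ => (1 : ℝ)) ω) + (1 - (p : ℝ)) / p * ((Fset G L Λ ω).card : ℝ) -
      ((Gset G L Λ ω).card : ℝ)) μ := hXW.sub hGi
  have hmono := integral_mono hHi hrhs_int hpt
  refine hmono.trans ?_
  have e0 := integral_sub hXW hGi
  have e1 := integral_add hX hW
  have e2 := integral_add hX1 hX2
  have e3 : ∫ ω, (1 - (p : ℝ)) * (T * (N ω / (2 * M) + M / 2)) ∂μ =
      (1 - p) * (T * ((a + ∑ i ∈ I, b i * μ.real (S i)) / (2 * M) + M / 2)) := by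
    rw [integral_const_mul, integral_const_mul, integral_add (hNi.div_const _) (integrable_const _),
      integral_div, hNint, integral_const, smul_eq_mul, probReal_univ, one_mul]
  rw [e0, e1, e2, e3,
    integral_const_mul ((1 - (p : ℝ)) * B) (fun ω => bad.indicator (fun _ => (1 : ℝ)) ω),
    integral_const_mul ((1 - (p : ℝ)) / p) (fun ω => ((Fset G L Λ ω).card : ℝ)),
    integral_indicator_const _ hbadm, smul_eq_mul, mul_one]
  -- `((1-p)/p) E|F| - E|G| = 0`
  have hFG := integral_card_Gset_eq (G := G) (L := L) (Λ := Λ) p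
  have hzero : (1 - (p : ℝ)) / p * ∫ ω, ((Fset G L Λ ω).card : ℝ) ∂μ = ∫ ω, ((Gset G L Λ ω).card : ℝ) ∂μ := by
    rw [div_mul_eq_mul_div, div_eq_iff hp0.ne', hFG, mul_comm]
  rw [hzero, add_sub_cancel_right]
  -- the bad event
  have hPbad : μ.real bad ≤ 2 * Λ.card * (edgesIn G Λ).card * Real.exp (-2 * (p : ℝ) ^ 2 * (1 - p) ^ 2 * t ^ 2) := by
    rw [hbad]; exact real_exists_bad_le (G := G) hΛL p hp0 hp1 ht
  have hB' : (1 - p) * B = 2 * (edgesIn G Λ).card / p := by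
    rw [hB, mul_div_assoc', mul_comm (1 - (p : ℝ)), mul_div_mul_right _ _ h1p.ne']
  have hBnn : 0 ≤ 2 * ((edgesIn G Λ).card : ℝ) / p :=
    div_nonneg (mul_nonneg zero_le_two (Nat.cast_nonneg _)) hp0.le
  rw [hB', hT]
  refine add_le_add (le_of_eq ?_) (mul_le_mul_of_nonneg_left hPbad hBnn)
  ring

end General

end Cerf2015BoxLRO16

end Summit.CriticalPhenomena.PercolationContinuityZ3.Theorems

end
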